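import Mathlib
import Summits.ValiantsHypothesis.ValiantsHypothesis.Theorems.GrenetZeonTwoDimCoefficientsDualUnipotentThinNumeratorGauge
import Summits.ValiantsHypothesis.ValiantsHypothesis.Theorems.GrenetZeonTwoDimCoefficientsDualUnipotentCentredNumerator
import Summits.ValiantsHypothesis.ValiantsHypothesis.Theorems.GrenetZeonTwoDimCoefficientsDualUnipotentCentredNumeratorPencil
import Summits.ValiantsHypothesis.ValiantsHypothesis.Theorems.GrenetZeonTwoDimCoefficientsDualUnipotentPowerTrace

/-!
# Crux `GrenetZeon.TwoDimCoefficients` (stmt-ValiantsHypothesis-8062) / rung `DualUnipotentThreeHalves` (stmt-24318):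
# the centred cross form in PENCIL / POWER-TRACE currency — exact formula and the two-sided span conditions

✓ `…CentredNumerator` (adjugate currency) proved the exact formula `Hess_p tr(adj A·B) = −c⁻¹·(Ψ + Ψᵀ)` with the centred
cross form `Ψ`.  This file transports it to the resolvent of an affine nilpotent pencil and to the power-trace normal form
(✓ `exists_powerTrace_of_dualUnipotentRepr`: `per_n = tr(N^n·E)`, `N` linear `2m × 2m`, `N^{2m} = 0`, `E` constant):

* `adjugate_map_eval_one_sub` — pointwise `adj(1 − N(p)) = c·K_p`, `K_p = Σ_{j<m} N(p)^j = (1 − N(p))⁻¹`, `c = det(1 − N)`.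
* ★★★ `hess0_transl_resolvent_eq_cross` — EXACT FORMULA, pencil currency: for affine `N`, `M` with `N^m = 0` and every `p`,
  `Hess_p (Σ_{j<m} tr(N^j·M)) = Ψ + Ψᵀ`, `Ψ(s,t) = tr(K_p·N_s·K_p·(M_t + N_t·K_p·M(p)))`.
* ★★★ `hess0_transl_resolvent_eq_cross_const` — power-trace currency (`M = E` constant):
  `Hess_p = Ψ + Ψᵀ`, `Ψ(s,t) = tr(K_p·N_s·K_p·N_t·K_p·E)` — the second derivative of `tr((1 − N)⁻¹·E)`.
* `rank_cross_const_le_right` / `rank_cross_const_le_left` — `rank Ψ ≤ rank[(N_t·K_p·E)]` and `rank Ψ ≤ rank[(E·K_p·N_t)]`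
  (factor `Ψ(s,t) = tr((K N_s K)·(N_t K E)) = tr((K N_t K)·(E K N_s))`).
* ★★ `sq_le_two_rank_cross_of_dualUnipotentRepr` — per side in the normal form at the Mignon–Ressayre point `p₀`:
  `(k+3)² ≤ 2·rank Ψ_{p₀}`, and (last conjunct) the LEFT span condition `(k+3)² ≤ 2·rank[(E·K_{p₀}·N_t)]` — the pencil
  directions left-multiplied by `E·(1 − N(p₀))⁻¹` span `≥ n²/2` dimensions (the right condition, `2·rank[(N_t·K_{p₀}·E)]`,
  is ✓ `sq_le_two_rank_pencil_mul_of_dualUnipotentRepr`).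

So conjecture (H) HessianRate in the normal form is EXACTLY: `rank_{(s,t)} tr(K_p N_s K_p N_t K_p E) ≤ C·m²/n` for nilpotent
linear pencils `N` carrying `per_n = tr(N^n E)` — R3′ of the g11 census with every presentation artefact removed.

HONEST FRAMING: helper for an ASIDE crux; closes no stub — `stub_dualUnipotent`, 24318, `stub_longMassSlowLawInv`, `VP ≠ VNP`
untouched.  No definitions, no named facts, no sorry.
-/

noncomputable section

-- single-conjunct layout `Summits/ValiantsHypothesis/ValiantsHypothesis`: the duplicated namespace component is mandated
set_option linter.dupNamespace false

namespace Summit.ValiantsHypothesis.ValiantsHypothesis.Theorems.GrenetZeon.CentredNumerator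

open MvPolynomial Matrix
open Literature.Computability.AlgebraicComplexity
open Summit.ValiantsHypothesis.ValiantsHypothesis.Theorems.GrenetZeon.ThinNumerator
open Summit.ValiantsHypothesis.ValiantsHypothesis.Cruxes.TwoDimCoefficients.DimTwoCases
  (AffMat IsAffine isAffine_one_sub exists_det_one_sub_eq_C trace_adjugate_one_sub_mul DualUnipotentRepr
    exists_powerTrace_of_dualUnipotentRepr perPoly_ne_C)

/-! ### §1 Pointwise bookkeeping for `1 − N` -/

section OneSub

variable {n m : ℕ}

/-- `(1 − N)(p) = 1 − N(p)`. [folklore] -/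
theorem map_eval_one_sub (N : AffMat n m) (p : Fin n × Fin n → ℂ) :
    (1 - N).map (eval p) = 1 - N.map (eval p) := by
  have e : ∀ X : AffMat n m, X.map (eval p) = (eval p).mapMatrix X := fun X => rfl
  rw [e, map_sub, map_one, ← e]

/-- The linear parts of `1 − N` are `−N_s`. [folklore] -/
theorem map_coeff_one_sub (N : AffMat n m) (s : Fin n × Fin n) :
    (1 - N).map (coeff (Finsupp.single s 1)) = -N.map (coeff (Finsupp.single s 1)) := by
  have h1 : (1 : AffMat n m).map (coeff (Finsupp.single s 1)) = 0 := by
    ext l j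
    rw [Matrix.map_apply, Matrix.one_apply, Matrix.zero_apply]
    split_ifs
    · rw [coeff_one, if_neg]
      exact (Finsupp.single_ne_zero.mpr one_ne_zero).symm
    · exact coeff_zero _
  rw [Matrix.map_sub _ (fun a b => by simp only [coeff_sub]), h1, zero_sub]

/-- Coefficients of `G·N` for a constant `G`: `coeff_d(G·N) = G·coeff_d(N)`. [folklore] -/
theorem map_coeff_map_C_mul (G : Matrix (Fin m) (Fin m) ℂ) (N : AffMat n m) (d : Fin n × Fin n →₀ ℕ) :
    (G.map (C : ℂ → MvPolynomial (Fin n × Fin n) ℂ) * N).map (coeff d) = G * N.map (coeff d) := by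
  ext i j
  simp only [Matrix.map_apply, Matrix.mul_apply, coeff_sum, coeff_C_mul]

/-- Coefficients of `N·G` for a constant `G`: `coeff_d(N·G) = coeff_d(N)·G`. [folklore] -/
theorem map_coeff_mul_map_C (N : AffMat n m) (G : Matrix (Fin m) (Fin m) ℂ) (d : Fin n × Fin n →₀ ℕ) :
    (N * G.map (C : ℂ → MvPolynomial (Fin n × Fin n) ℂ)).map (coeff d) = N.map (coeff d) * G := by
  have h := map_coeff_add_mul N 0 G d
  rwa [zero_add, Matrix.map_zero _ (coeff_zero _), zero_add] at h

/-- **Pointwise adjugate of `1 − N(p)`.**  If `N^m = 0` and `det(1 − N) = c` then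
`adj(1 − N(p)) = c·Σ_{j<m} N(p)^j`. [folklore] -/
theorem adjugate_map_eval_one_sub (N : AffMat n m) (hnil : N ^ m = 0) {c : ℂ} (hdet : (1 - N).det = C c)
    (p : Fin n × Fin n → ℂ) :
    ((1 - N).map (eval p)).adjugate = c • ∑ j ∈ Finset.range m, N.map (eval p) ^ j := by
  have hK : (1 - N.map (eval p)) * ∑ j ∈ Finset.range m, N.map (eval p) ^ j = 1 := by
    rw [mul_neg_geom_sum, map_eval_pow_eq_zero N hnil p, sub_zero]
  have hc : ((1 - N).map (eval p)).det = c := det_map_eval (1 - N) hdet p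
  calc ((1 - N).map (eval p)).adjugate
      = ((1 - N).map (eval p)).adjugate * ((1 - N.map (eval p)) * ∑ j ∈ Finset.range m, N.map (eval p) ^ j) := by
        rw [hK, Matrix.mul_one]
    _ = c • ∑ j ∈ Finset.range m, N.map (eval p) ^ j := by
        rw [← Matrix.mul_assoc, ← map_eval_one_sub, Matrix.adjugate_mul, hc, Matrix.smul_mul, Matrix.one_mul]

end OneSub

/-! ### §2 The exact formula in pencil currency -/

section Exact

variable {n m : ℕ}

/-- ★★★ **Exact Hessian of the resolvent trace.**  For affine `N`, `M` with `N^m = 0` and every point `p`: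
`Hess_p (Σ_{j<m} tr(N^j·M)) = Ψ + Ψᵀ`, `Ψ(s,t) = tr(K·N_s·K·(M_t + N_t·K·M(p)))`, `K = Σ_{j<m} N(p)^j = (1 − N(p))⁻¹`.
[folklore] -/
theorem hess0_transl_resolvent_eq_cross (N M : AffMat n m) (hN : IsAffine N) (hM : IsAffine M)
    (hnil : N ^ m = 0) (p : Fin n × Fin n → ℂ) :
    hess0 (transl p (∑ j ∈ Finset.range m, (N ^ j * M).trace)) =
      (Matrix.of fun s t : Fin n × Fin n =>
        ((∑ j ∈ Finset.range m, N.map (eval p) ^ j) * N.map (coeff (Finsupp.single s 1)) *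
          (∑ j ∈ Finset.range m, N.map (eval p) ^ j) *
          (M.map (coeff (Finsupp.single t 1)) +
            N.map (coeff (Finsupp.single t 1)) * ((∑ j ∈ Finset.range m, N.map (eval p) ^ j) * M.map (eval p)))).trace) +
      (Matrix.of fun s t : Fin n × Fin n =>
        ((∑ j ∈ Finset.range m, N.map (eval p) ^ j) * N.map (coeff (Finsupp.single s 1)) *
          (∑ j ∈ Finset.range m, N.map (eval p) ^ j) *
          (M.map (coeff (Finsupp.single t 1)) +
            N.map (coeff (Finsupp.single t 1)) * ((∑ j ∈ Finset.range m, N.map (eval p) ^ j) * M.map (eval p)))).trace)ᵀ := by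
  obtain ⟨c, hc, hdet⟩ := exists_det_one_sub_eq_C N hnil
  set K : Matrix (Fin m) (Fin m) ℂ := ∑ j ∈ Finset.range m, N.map (eval p) ^ j with hK
  have hsum : ∑ j ∈ Finset.range m, (N ^ j * M).trace = C c⁻¹ * ((1 - N).adjugate * M).trace := by
    rw [trace_adjugate_one_sub_mul N M hnil, hdet, ← mul_assoc, ← C_mul, inv_mul_cancel₀ hc, C_1, one_mul]
  rw [hsum, map_mul, transl_C, hess0_C_mul,
    hess0_transl_eq_centred_cross (1 - N) M (isAffine_one_sub N hN) hM hc hdet p,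
    adjugate_map_eval_one_sub N hnil hdet p, ← hK]
  refine Matrix.ext fun s t => ?_
  simp only [Matrix.add_apply, Matrix.smul_apply, Matrix.transpose_apply, Matrix.of_apply, map_coeff_one_sub,
    Matrix.smul_mul, Matrix.mul_smul, Matrix.neg_mul, Matrix.mul_neg, Matrix.trace_neg, Matrix.trace_smul,
    smul_smul, smul_eq_mul, inv_mul_cancel₀ hc, one_smul, sub_neg_eq_add]
  field_simp
  ring

/-- ★★★ **Exact Hessian in power-trace currency** (`M = E` constant): `Hess_p (Σ_{j<m} tr(N^j·E)) = Ψ + Ψᵀ`,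
`Ψ(s,t) = tr(K·N_s·K·N_t·K·E)`, `K = Σ_{j<m} N(p)^j` — the second derivative of `tr((1 − N)⁻¹·E)`. [folklore] -/
theorem hess0_transl_resolvent_eq_cross_const (N : AffMat n m) (hN : IsAffine N) (E : Matrix (Fin m) (Fin m) ℂ)
    (hnil : N ^ m = 0) (p : Fin n × Fin n → ℂ) :
    hess0 (transl p (∑ j ∈ Finset.range m, (N ^ j * E.map C).trace)) =
      (Matrix.of fun s t : Fin n × Fin n =>
        ((∑ j ∈ Finset.range m, N.map (eval p) ^ j) * N.map (coeff (Finsupp.single s 1)) *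
          (∑ j ∈ Finset.range m, N.map (eval p) ^ j) *
          (N.map (coeff (Finsupp.single t 1)) * ((∑ j ∈ Finset.range m, N.map (eval p) ^ j) * E))).trace) +
      (Matrix.of fun s t : Fin n × Fin n =>
        ((∑ j ∈ Finset.range m, N.map (eval p) ^ j) * N.map (coeff (Finsupp.single s 1)) *
          (∑ j ∈ Finset.range m, N.map (eval p) ^ j) *
          (N.map (coeff (Finsupp.single t 1)) * ((∑ j ∈ Finset.range m, N.map (eval p) ^ j) * E))).trace)ᵀ := by
  have hMaff : IsAffine (E.map (C : ℂ → MvPolynomial (Fin n × Fin n) ℂ)) := fun i j => by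
    rw [Matrix.map_apply, totalDegree_C]; exact Nat.zero_le _
  have hMt : ∀ t : Fin n × Fin n,
      (E.map (C : ℂ → MvPolynomial (Fin n × Fin n) ℂ)).map (coeff (Finsupp.single t 1)) = 0 := fun t => by
    ext l j
    rw [Matrix.map_apply, Matrix.map_apply, coeff_C, if_neg, Matrix.zero_apply]
    exact (Finsupp.single_ne_zero.mpr one_ne_zero).symm
  have hMp : (E.map (C : ℂ → MvPolynomial (Fin n × Fin n) ℂ)).map (eval p) = E := by
    rw [Matrix.map_map]
    have hc : (⇑(eval p) ∘ (C : ℂ → MvPolynomial (Fin n × Fin n) ℂ)) = id := funext fun x => by simp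
    rw [hc, Matrix.map_id]
  rw [hess0_transl_resolvent_eq_cross N (E.map C) hN hMaff hnil p]
  refine Matrix.ext fun s t => ?_
  simp only [Matrix.add_apply, Matrix.transpose_apply, Matrix.of_apply, hMt, hMp, zero_add]

end Exact

/-! ### §3 Rank of the cross form: the right and left span conditions -/

section Rank

variable {n m : ℕ}

/-- Cyclic rearrangement `tr(K·Y·K·E·K·X) = tr(K·X·K·Y·K·E)`. [folklore] -/
theorem trace_cycle_aux (K X Y E : Matrix (Fin m) (Fin m) ℂ) :
    (K * Y * K * (E * K * X)).trace = (K * X * K * (Y * (K * E))).trace := by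
  rw [show K * Y * K * (E * K * X) = (K * Y * K * E * K) * X by simp only [Matrix.mul_assoc],
    Matrix.trace_mul_comm,
    show X * (K * Y * K * E * K) = (X * K * Y * K * E) * K by simp only [Matrix.mul_assoc],
    Matrix.trace_mul_comm]
  simp only [Matrix.mul_assoc]

/-- `rank Ψ ≤ rank[(N_t·K·E)_{lk}]_{(l,k),t}` (factor `Ψ(s,t) = tr((K N_s K)·(N_t K E))`). [folklore] -/
theorem rank_cross_const_le_right (N : AffMat n m) (E K : Matrix (Fin m) (Fin m) ℂ) :
    (Matrix.of fun s t : Fin n × Fin n =>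
        (K * N.map (coeff (Finsupp.single s 1)) * K * (N.map (coeff (Finsupp.single t 1)) * (K * E))).trace).rank ≤
      (Matrix.of fun (lk : Fin m × Fin m) (t : Fin n × Fin n) =>
        (N.map (coeff (Finsupp.single t 1)) * (K * E)) lk.1 lk.2).rank := by
  have h := rank_of_trace_mul_mul_coeff_le (fun s => K * N.map (coeff (Finsupp.single s 1)) * K) 1
    (N * (K * E).map (C : ℂ → MvPolynomial (Fin n × Fin n) ℂ))
  have e1 : (Matrix.of fun s t : Fin n × Fin n =>
        (K * N.map (coeff (Finsupp.single s 1)) * K * 1 *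
          (N * (K * E).map (C : ℂ → MvPolynomial (Fin n × Fin n) ℂ)).map (coeff (Finsupp.single t 1))).trace) =
      Matrix.of fun s t : Fin n × Fin n =>
        (K * N.map (coeff (Finsupp.single s 1)) * K * (N.map (coeff (Finsupp.single t 1)) * (K * E))).trace := by
    refine Matrix.ext fun s t => ?_
    rw [Matrix.of_apply, Matrix.of_apply, Matrix.mul_one, map_coeff_mul_map_C]
  have e2 : (Matrix.of fun (lk : Fin m × Fin m) (t : Fin n × Fin n) =>
        coeff (Finsupp.single t 1) ((N * (K * E).map (C : ℂ → MvPolynomial (Fin n × Fin n) ℂ)) lk.1 lk.2)) =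
      Matrix.of fun (lk : Fin m × Fin m) (t : Fin n × Fin n) =>
        (N.map (coeff (Finsupp.single t 1)) * (K * E)) lk.1 lk.2 := by
    refine Matrix.ext fun lk t => ?_
    have hc := congr_fun (congr_fun (map_coeff_mul_map_C N (K * E) (Finsupp.single t 1)) lk.1) lk.2
    rw [Matrix.map_apply] at hc
    rw [Matrix.of_apply, Matrix.of_apply, hc]
  rw [e1, e2] at h
  exact h

/-- `rank Ψ ≤ rank[(E·K·N_s)_{lk}]_{(l,k),s}` (factor `Ψ(s,t) = tr((K N_t K)·(E K N_s))`). [folklore] -/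
theorem rank_cross_const_le_left (N : AffMat n m) (E K : Matrix (Fin m) (Fin m) ℂ) :
    (Matrix.of fun s t : Fin n × Fin n =>
        (K * N.map (coeff (Finsupp.single s 1)) * K * (N.map (coeff (Finsupp.single t 1)) * (K * E))).trace).rank ≤
      (Matrix.of fun (lk : Fin m × Fin m) (s : Fin n × Fin n) =>
        (E * K * N.map (coeff (Finsupp.single s 1))) lk.1 lk.2).rank := by
  have h := rank_of_trace_mul_mul_coeff_le (fun t => K * N.map (coeff (Finsupp.single t 1)) * K) 1
    ((E * K).map (C : ℂ → MvPolynomial (Fin n × Fin n) ℂ) * N)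
  -- the matrix bounded by `h` is the transpose of `Ψ`
  have e1 : (Matrix.of fun t s : Fin n × Fin n =>
        (K * N.map (coeff (Finsupp.single t 1)) * K * 1 *
          ((E * K).map (C : ℂ → MvPolynomial (Fin n × Fin n) ℂ) * N).map (coeff (Finsupp.single s 1))).trace) =
      (Matrix.of fun s t : Fin n × Fin n =>
        (K * N.map (coeff (Finsupp.single s 1)) * K * (N.map (coeff (Finsupp.single t 1)) * (K * E))).trace)ᵀ := by
    refine Matrix.ext fun t s => ?_
    rw [Matrix.transpose_apply, Matrix.of_apply, Matrix.of_apply, Matrix.mul_one, map_coeff_map_C_mul]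
    exact trace_cycle_aux K _ _ E
  have e2 : (Matrix.of fun (lk : Fin m × Fin m) (s : Fin n × Fin n) =>
        coeff (Finsupp.single s 1) (((E * K).map (C : ℂ → MvPolynomial (Fin n × Fin n) ℂ) * N) lk.1 lk.2)) =
      Matrix.of fun (lk : Fin m × Fin m) (s : Fin n × Fin n) =>
        (E * K * N.map (coeff (Finsupp.single s 1))) lk.1 lk.2 := by
    refine Matrix.ext fun lk s => ?_
    have hc := congr_fun (congr_fun (map_coeff_map_C_mul (E * K) N (Finsupp.single s 1)) lk.1) lk.2
    rw [Matrix.map_apply] at hc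
    rw [Matrix.of_apply, Matrix.of_apply, hc]
  rw [e1, e2, Matrix.rank_transpose] at h
  exact h

/-- ★★ `rank Hess_p ≤ 2·rank Ψ` in power-trace currency. [folklore] -/
theorem rank_hess0_resolvent_const_le_two_rank_cross (N : AffMat n m) (hN : IsAffine N)
    (E : Matrix (Fin m) (Fin m) ℂ) (hnil : N ^ m = 0) (p : Fin n × Fin n → ℂ) :
    (hess0 (transl p (∑ j ∈ Finset.range m, (N ^ j * E.map C).trace))).rank ≤
      2 * (Matrix.of fun s t : Fin n × Fin n =>
        ((∑ j ∈ Finset.range m, N.map (eval p) ^ j) * N.map (coeff (Finsupp.single s 1)) *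
          (∑ j ∈ Finset.range m, N.map (eval p) ^ j) *
          (N.map (coeff (Finsupp.single t 1)) * ((∑ j ∈ Finset.range m, N.map (eval p) ^ j) * E))).trace).rank := by
  rw [hess0_transl_resolvent_eq_cross_const N hN E hnil p]
  refine (rank_add_le' _ _).trans ?_
  rw [Matrix.rank_transpose]
  omega

end Rank

/-! ### §4 Per side in the power-trace normal form -/

section Per

variable {m : ℕ}

/-- ★★ **Per side: the centred cross form at the Mignon–Ressayre point has rank `≥ n²/2`**, and consequently the LEFT
span condition `(k+3)² ≤ 2·rank[(E·K_{p₀}·N_t)]` (the right one is ✓ `sq_le_two_rank_pencil_mul_of_dualUnipotentRepr`).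
[folklore] -/
theorem sq_le_two_rank_cross_of_dualUnipotentRepr (k : ℕ) (hrep : DualUnipotentRepr (k + 3) m) :
    ∃ (N : AffMat (k + 3) (m + m)) (E : Matrix (Fin (m + m)) (Fin (m + m)) ℂ),
      (∀ i j, (N i j).IsHomogeneous 1) ∧ N ^ (m + m) = 0 ∧ E * E = 0 ∧
      perPoly (Fin (k + 3)) ℂ = (N ^ (k + 3) * E.map C).trace ∧
      (∀ j : ℕ, j ≠ k + 3 → (N ^ j * E.map C).trace = 0) ∧
      (k + 3) ^ 2 ≤ 2 * (Matrix.of fun s t : Fin (k + 3) × Fin (k + 3) =>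
        ((∑ j ∈ Finset.range (m + m), N.map (eval (mrPoint ℂ k)) ^ j) * N.map (coeff (Finsupp.single s 1)) *
          (∑ j ∈ Finset.range (m + m), N.map (eval (mrPoint ℂ k)) ^ j) *
          (N.map (coeff (Finsupp.single t 1)) *
            ((∑ j ∈ Finset.range (m + m), N.map (eval (mrPoint ℂ k)) ^ j) * E))).trace).rank ∧
      (k + 3) ^ 2 ≤ 2 * (Matrix.of fun (lk : Fin (m + m) × Fin (m + m)) (s : Fin (k + 3) × Fin (k + 3)) =>
        (E * (∑ j ∈ Finset.range (m + m), N.map (eval (mrPoint ℂ k)) ^ j) *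
          N.map (coeff (Finsupp.single s 1))) lk.1 lk.2).rank := by
  obtain ⟨N, E, hhom, hnil, hE, hper, hcon⟩ := exists_powerTrace_of_dualUnipotentRepr (by omega) hrep
  have hN : IsAffine N := fun i j => (hhom i j).totalDegree_le
  have hlt : k + 3 < m + m := by
    by_contra hge
    rw [not_lt] at hge
    apply perPoly_ne_C (n := k + 3) (by omega) 0
    rw [hper, pow_eq_zero_of_le hge hnil, Matrix.zero_mul, Matrix.trace_zero, map_zero]
  have hR : ∑ j ∈ Finset.range (m + m), (N ^ j * E.map C).trace = perPoly (Fin (k + 3)) ℂ := by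
    rw [hper, Finset.sum_eq_single (k + 3) (fun j _ hj => hcon j hj)
      (fun h => absurd (Finset.mem_range.mpr hlt) h)]
  have hrank : (hess0 (transl (mrPoint ℂ k) (∑ j ∈ Finset.range (m + m), (N ^ j * E.map C).trace))).rank =
      (k + 3) ^ 2 := by
    rw [hR, hess0_transl_mrPoint_perPoly, rank_smul_eq (by exact_mod_cast Nat.factorial_ne_zero k), rank_mrHess]
  have h := rank_hess0_resolvent_const_le_two_rank_cross N hN E hnil (mrPoint ℂ k)
  rw [hrank] at h
  exact ⟨N, E, hhom, hnil, hE, hper, hcon, h,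
    h.trans (Nat.mul_le_mul_left 2 (rank_cross_const_le_left N E _))⟩

end Per

/-! ### §5 (appended) CORRECTION, and the skew freedom of `Ψ`

The module docstring's sentence "(H) … is EXACTLY: `rank_{(s,t)} tr(K_p N_s K_p N_t K_p E) ≤ C·m²/n`" OVERSTATES.  The exact
invariant is `rank(Ψ + Ψᵀ) = rank Hess_p` (`hess0_transl_resolvent_eq_cross_const`); `rank Ψ ≤ C·m²/n` is SUFFICIENT for
(H) (`rank_hess0_resolvent_const_le_two_rank_cross`) but not necessary: the numerator `E` of the normal form is not unique — it
may be changed by any constant `E'` INVISIBLE to every power trace (`tr(N^j·E') ≡ 0` for all `j`), which leaves `per`, the trace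
constraints and every Hessian unchanged (`hess0_transl_resolvent_add_invisible`) but adds to `Ψ` the form `Ψ[E']`, which by
the exact formula is SKEW (`cross_const_add_transpose_eq_zero_of_invisible`) and may have large rank.  So
(H) ⟺ `rank(Ψ[E] + Ψ[E]ᵀ) ≤ C·m²/n`; the per-side NECESSARY conditions of §4 and of ✓ `…CentredNumeratorPencil`
(`n² ≤ 2·rank Ψ`, the two span conditions) are unaffected — they hold for EVERY admissible `E`. -/

section Skew

variable {n m : ℕ}

/-- **Skew freedom.**  If the constant `E'` is invisible to every power trace of the pencil (`tr(N^j·E') = 0` for all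
`j < m`; `N^m = 0`), then its cross form is skew at every point: `Ψ[E'] + Ψ[E']ᵀ = 0` (the resolvent trace of `E'` is the
zero polynomial, so its Hessian vanishes). [folklore] -/
theorem cross_const_add_transpose_eq_zero_of_invisible (N : AffMat n m) (hN : IsAffine N)
    (E' : Matrix (Fin m) (Fin m) ℂ) (hnil : N ^ m = 0)
    (hinv : ∀ j < m, (N ^ j * E'.map (C : ℂ → MvPolynomial (Fin n × Fin n) ℂ)).trace = 0)
    (p : Fin n × Fin n → ℂ) :
    (Matrix.of fun s t : Fin n × Fin n =>
        ((∑ j ∈ Finset.range m, N.map (eval p) ^ j) * N.map (coeff (Finsupp.single s 1)) *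
          (∑ j ∈ Finset.range m, N.map (eval p) ^ j) *
          (N.map (coeff (Finsupp.single t 1)) * ((∑ j ∈ Finset.range m, N.map (eval p) ^ j) * E'))).trace) +
      (Matrix.of fun s t : Fin n × Fin n =>
        ((∑ j ∈ Finset.range m, N.map (eval p) ^ j) * N.map (coeff (Finsupp.single s 1)) *
          (∑ j ∈ Finset.range m, N.map (eval p) ^ j) *
          (N.map (coeff (Finsupp.single t 1)) * ((∑ j ∈ Finset.range m, N.map (eval p) ^ j) * E'))).trace)ᵀ = 0 := by
  rw [← hess0_transl_resolvent_eq_cross_const N hN E' hnil p,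
    Finset.sum_eq_zero (fun j hj => hinv j (Finset.mem_range.mp hj)), map_zero, map_zero]

/-- Consequently an invisible `E'` may be added to the numerator without changing the resolvent trace, hence without
changing any Hessian: `R[E + E'] = R[E]`. [folklore] -/
theorem resolvent_add_invisible (N : AffMat n m) (E E' : Matrix (Fin m) (Fin m) ℂ)
    (hinv : ∀ j < m, (N ^ j * E'.map (C : ℂ → MvPolynomial (Fin n × Fin n) ℂ)).trace = 0) :
    ∑ j ∈ Finset.range m, (N ^ j * (E + E').map (C : ℂ → MvPolynomial (Fin n × Fin n) ℂ)).trace =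
      ∑ j ∈ Finset.range m, (N ^ j * E.map (C : ℂ → MvPolynomial (Fin n × Fin n) ℂ)).trace := by
  rw [Matrix.map_add C (map_add C) E E']
  simp only [Matrix.mul_add, Matrix.trace_add, Finset.sum_add_distrib]
  rw [Finset.sum_eq_zero (fun j hj => hinv j (Finset.mem_range.mp hj)), add_zero]

/-- `Hess_p R[E + E'] = Hess_p R[E]` for an invisible `E'`. [folklore] -/
theorem hess0_transl_resolvent_add_invisible (N : AffMat n m) (E E' : Matrix (Fin m) (Fin m) ℂ)
    (hinv : ∀ j < m, (N ^ j * E'.map (C : ℂ → MvPolynomial (Fin n × Fin n) ℂ)).trace = 0)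
    (p : Fin n × Fin n → ℂ) :
    hess0 (transl p (∑ j ∈ Finset.range m, (N ^ j * (E + E').map (C : ℂ → MvPolynomial (Fin n × Fin n) ℂ)).trace)) =
      hess0 (transl p (∑ j ∈ Finset.range m, (N ^ j * E.map (C : ℂ → MvPolynomial (Fin n × Fin n) ℂ)).trace)) := by
  rw [resolvent_add_invisible N E E' hinv]

end Skew

end Summit.ValiantsHypothesis.ValiantsHypothesis.Theorems.GrenetZeon.CentredNumerator

end
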